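import Summits.HodgeConjecture.HodgeConjecture.Theorems.F0D9opRoad2Mod
import Literature.AlgebraicGeometry.Motives.IntegralModelTameQuotientDescendedAction
import Literature.AlgebraicGeometry.Motives.VarietiesProperProofs
import Literature.AlgebraicGeometry.Motives.GaloisThickeningIntegralPackage
import Literature.AlgebraicGeometry.Limits.LocalizationActionSpreadLocalise
import Summits.HodgeConjecture.HodgeConjecture.Theorems.F0P6qTameLevelQuotient
import Summits.HodgeConjecture.HodgeConjecture.Theorems.F0P6aModuliDatumDefs
import Summits.HodgeConjecture.HodgeConjecture.Theorems.F0P6cIsogenyDictionary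
import Summits.HodgeConjecture.HodgeConjecture.Theorems.F0P6aRGDAssemblyDefs
import Summits.HodgeConjecture.HodgeConjecture.Theorems.F0P6aPELInputs
import Summits.HodgeConjecture.HodgeConjecture.Theorems.F0P6aDatumOfInputsDefs
import Summits.HodgeConjecture.HodgeConjecture.Theorems.F0P6aPELSpreadDefs
import Summits.HodgeConjecture.HodgeConjecture.Theorems.F0P6aStubGEN
import Summits.HodgeConjecture.HodgeConjecture.Theorems.F0P6aStubGSPREAD
import Literature.AlgebraicGeometry.AbelianSchemes.DualPairOfAmpleRigidified
import Summits.HodgeConjecture.HodgeConjecture.Theorems.F0P6aStubHFROBSigma2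
import Summits.HodgeConjecture.HodgeConjecture.Theorems.F0P6aStubDOWN
import Summits.HodgeConjecture.HodgeConjecture.Theorems.F0P6aStubFROB
import HarnessLib.Audit.LibrarySuggestionsDenyListCruxes

/-!
# `F0P6aModuliDatum` — ★ RE-HOME (K6 «MAIN + PARENT» row; rung-0 re-homing, LEAD F0P6-plan «M-72»∕«M-139a»∕«M-140» (4); desk F0P6a-plan (g7) cut sheet v10) of the crux workfile `Lines/F0_P6a_ModuliDatum.lean`

**SIZE-LINT SPLIT ×3** (`Theorems/` files with proofs are ≤ 400 lines): parts `Theorems/F0P6aModuliDatumLetters.lean` → `Theorems/F0P6aModuliDatumLayers.lean` → `Theorems/F0P6aModuliDatum.lean`, each importing the previous, cut at declaration boundaries of `Lines/F0_P6a_ModuliDatum.lean`; namespaces AND sections KEPT and re-opened per part (with their `open`∕`variable` lines replayed verbatim); the options preamble is repeated. This is PART 1.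

This `Theorems/` module is the TREE BYTES of `Summits/HodgeConjecture/HodgeConjecture/Cruxes/HLiu418/Lines/F0_P6a_ModuliDatum.lean` (edition of record ED. 10 (S1), tree sha16 adc1f6959b94cbf0, 794 l.,
code-`sorry`-free, 0 sockets) with the NAMESPACE KEPT — `Summit.HodgeConjecture.HodgeConjecture.Cruxes.HLiu418.F0P6aModuliDatum` — so that every fully-qualified name is UNCHANGED (0 FQN moves, 0 downstream bytes; outside reader:
parent `Lines/F0_D9opRoad2.lean` :90 `F0P6aModuliDatum.pwcore_holds` (FQN kept ★-side ⇒ resolves through the import; no alias needed)).  Statement AND proof bytes of every declaration, docstrings included, are the workfile՚s; the only edits are (a) this re-headed module docstring,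
(b) the 14 `Lines` imports switched to their ★ re-homed twins (bare `import` lines — farm header canonical; provenance listed under «Import provenance» below; NO `Cruxes/…/Lines` import survives — NO-CROSS-IMPORT, «M-72» (3)); the L1 leaf import `Lines.F0_P6a_StubLINES` is DROPPED (K6 «fold» option: MAIN reads the hub organ head `L1Fold.stub_LINES_of_organs`, by which the hub՚s `stub_LINES` is defined — junction `example : type_of% @stub_LINES := @L1Fold.stub_LINES_of_organs`, hub ED. 3 :783), and (c) the non-import hunk(s) forced by (b): tree :574 `exists_levelQuotientAction_isGeometricQuotient` → `Literature.AlgebraicGeometry.ShimuraVarieties.UnitaryCanonicalModel.RecordSystemGS.exists_levelQuotientAction_isGeometricQuotient`; tree :654 `datum_of_inputs` → `(Summit.HodgeConjecture.HodgeConjecture.Cruxes.HLiu418.F0P6aDatumOfInputs.datum_of_inputs_star`; tree :655 `stub_LINES_of_organs` → `@Summit.HodgeConjecture.HodgeConjecture.Cruxes.HLiu418.F0P6aDatumOfInputs.L1Fold.stub_LINES_of_organs` (same constants under their importable ★ names; see the cut sheet for why each is a pure re-pointing).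
(d) RELOCATION CURE (gate rule «STATE IT INLINE», p852785∕6; LA-ref1 BOX K5 #R1; ★ precedent `Theorems/F0P6aModuliDatumDefs.lean`): on the docstrings of the header-CLOSED Props `RecordModuliPointwiseCoreUpstairsCofinal`, `RecordGaloisQuotientDescent`, `RecordModuliHeartCofinal` every `[cite: …]` token is respelled `(print: …)` (same locators, docstring-only; the workfile keeps `[cite:]`), so the gate does not move them to `Literature/…`.
It asserts nothing beyond what the workfile already proves; every kept head is [propext, Classical.choice, Quot.sound] on the tree bytes.
After this file is ★ the `Lines/` workfile becomes ED. 11 = a one-import SHIM of it (a `crux write` on the LEAD՚s word, in ONE request with the other K6 shims over the reverse closure),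
so no environment ever holds two copies of a declaration.
HC_CM is proved only modulo the printed citations (2 remaining named inputs: hLiu418 = stmt-HodgeConjecture-24832, h413 = stmt-HodgeConjecture-24833) until rung 0 closes; a re-home is count-neutral.

## Import provenance (K6 switch map; the `import` lines above are bare on purpose — a trailing comment makes the farm router bypass header routing)
- ★ `…Theorems.F0D9opRoad2Mod` ← was `…Lines.F0D9opRoad2Mod` — ★ K4 twin p851028 (letters `RecordModuliPointwiseCoreCofinal` …; was the `Lines.F0D9opRoad2Mod` shim)
- `Literature.AlgebraicGeometry.Motives.GaloisThickeningIntegralPackage` (unchanged) — tree note: ★ GEO-PKG (A-p18 (g27) p845032): GAL ∕ GAL-2 ∕ GAL-4 ∕ GAL-5, PROJ-SPREAD, stable affine opens, units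
- `Literature.AlgebraicGeometry.Limits.LocalizationActionSpreadLocalise` (unchanged) — tree note: ★ EQV-SPREAD `IntegralModel.eventually_exists_actionOver_localise` (A-p03 ∕ A-p01 p844965 ∕ p845041)
- ★ `…Theorems.F0P6qTameLevelQuotient` ← was `…Lines.F0_P6q_TameLevelQuotient` — ★ K4 twin p851062 (was the `Lines.F0_P6q_TameLevelQuotient` shim; its one `alias` is replaced by hunk (i)) — tree note: ★ re-home `exists_levelQuotientAction_isGeometricQuotient` (σ)
- ★ `…Theorems.F0P6aModuliDatumDefs` ← was `…Lines.F0_P6a_ModuliDatumDefs` — ★ K4 twin p851243 (+ Readings∕Tuples∕Datum by import): `ModuliDatum`, `RecordModuliDatumCofinal`, letters — tree note: ED. 3: DEFS companion (`ModuliDatum`, `HeartFrob`, letters RGD ∕ HFROB ∕ HEART; imports DICT + ★ GEO-PKG + ★ FROB-SHEET-sheetwise)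
- ★ `…Theorems.F0P6cIsogenyDictionary` ← was `…Lines.F0_P6c_IsogenyDictionary` — ★ K4 twin p851045: `PointDictionary`, `frobeniusDichotomy_of_pointDictionary` — tree note: DICT `PointDictionary`, `frobeniusDichotomy_of_pointDictionary` (F0P6c-plan (g0))
- ★ `…Theorems.F0P6aRGDAssemblyDefs` ← was `…Lines.F0_P6a_RGDAssembly` — ★ K5-H1 twin (parts Letters p852776 → Inputs → Defs): PARAMETRIC head `rgd_of_inputs`, `RGDInputsAt` — tree note: ED. 5 (R): GEN heir A-p18 (g31) RGD SPINE `rgd_of_parts` over `stub_PEL` ∕ `stub_DATUM` (4819bd2d9dd79ad2)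
- ★ `…Theorems.F0P6aPELInputs` ← was `…Lines.F0_P6a_PELInputs` — ★ K6 twin (P-column; sorry-free B-class module): PARAMETRIC head `pel_of_inputs` — tree note: ED. 7 (M-53 (6)): the P-LINE `pel_of_line : RecordPELInputsCofinal` (A-p13 (g37) ∕ desk F0P6a-plan; sockets `stub_DUALS` ∕ `stub_SPREAD`)
- ★ `…Theorems.F0P6aDatumOfInputsDefs` ← was `…Lines.F0_P6a_DatumOfInputs` — ★ K5-H2∕K6 «L2-0» host of the D-side head `datum_of_inputs_star` + the socket-type Props ((H1b′) shape, «M-140a»); OF RECORD since 22:01:03Z: K5-H2 PART 4 = LAST `Theorems/F0P6aDatumOfInputsDefs.lean` (5549158e46e662a9 :207), `stub_LINES` ★-side BY TERM :61 — tree note: ED. 7 (M-53 (6)): the D-LINE `datum_of_line : RecordDatumOfInputs` (F0P6c-plan (g4); sockets `stub_LINES` ∕ `stub_DOWN` ∕ `stub_FROB`)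
- (dropped) `…Lines.F0_P6a_StubLINES` — K6 «fold» option: the L1 leaf import is DROPPED — MAIN passes the hub organ head `F0P6aDatumOfInputs.L1Fold.stub_LINES_of_organs` (hub ED. 3 :725, the term `stub_LINES` :780 is defined by; ★ K5-H2 PART 3 `Theorems.F0P6aDatumOfInputsDefsOrgans`) instead of the leaf՚s `StubLINES.stub_LINES_of_organs`
- ★ `…Theorems.F0P6aPELSpreadDefs` ← was `…Lines.F0_P6a_PELSpread` — ★ K5-H3 twin (hub minus sockets): `spread_of_parts`, `stub_INJ0` (PAID) — tree note: ED. 8 (M-55 (c) ∕ M-66 NEXT ∕ SOCKET PLAN (A)): the L4 CLOSER LEAF — parametric head `spread_of_parts (hG) (hI) (hL) : DualPairOfAmpleRigidified → RecordPELSpreadCofinal`, `stub_INJ0` PAID in-leaf, sockets `stub_GSPREAD` ∕ `stub_ELAWS` paid BY WRITE by closer leaves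
- ★ `…Theorems.F0P6aStubGEN` ← was `…Lines.F0_P6a_StubGEN` — ★ K6 twin (GEN closer leaf): head `elaws_of_line` — ★ ACCEPTED p853316 (tree `Theorems/F0P6aStubGEN.lean`) — tree note: ED. 8: GEN closer leaf (A-p18) — head `elaws_of_line : type_of% @F0P6aPELSpread.stub_ELAWS` (= by `rfl`) := `elaws_of_parts stub_GEN heckeZip_holds twistZip_holds`; socket `stub_GEN`
- ★ `…Theorems.F0P6aStubGSPREAD` ← was `…Lines.F0_P6a_StubGSPREAD` — ★ K6 twin ((A2) GSPREAD closer leaf): head `gspread_of_line` — ★ ACCEPTED p853238 (tree `Theorems/F0P6aStubGSPREAD.lean`) — tree note: ED. 9: (A2) GSPREAD closer leaf (LA4-p03 (g2)) — head `gspread_of_line : type_of% @F0P6aPELSpread.stub_GSPREAD`, SORRY-FREE (★ p849094 last mile + ★ p847908 rows), TRIO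
- `Literature.AlgebraicGeometry.AbelianSchemes.DualPairOfAmpleRigidified` (unchanged) — tree note: ED. 9: ★ `MumfordDual.dualPairOfAmpleRigidified : type_of% @F0P6aPELInputs.stub_DUALS` (LA6-p02 ★ p849111∕p849136; LA4-plan (g2) tie 5c6192d7 on the P-LINE ED. 2 olean) — DUALS paid hypothesis-free
- ★ `…Theorems.F0P6aStubHFROBSigma2` ← was `…Lines.F0_P6a_StubHFROBSigma2` — ★ K4 twin p851308: BRICK Σ2 `heartFrob_of_twistIdeal_ne_bot` — tree note: ED. 6 (M-33): the Σ-LINE `heartFrob_of_twistIdeal_ne_bot` (A-p13 (g36) ∕ A-p03 (g30), M-32) over ★ Σ p847054 + ★ T p846893 + ★ P p846958; reads Defs ED. 3 `twistIdeal_ne_bot`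
- ★ `…Theorems.F0P6aStubDOWN` ← was `…Lines.F0_P6a_StubDOWN` — ★ K6 twin (L2 closer leaf, LAST part = stem): head `stub_DOWN_of_organs` — ★ ACCEPTED p853585 (tree `Theorems/F0P6aStubDOWN.lean`) — tree note: ED. 10 (S1): the L2 CLOSER LEAF (LA2 chair) ED. 5 (leaf bytes sha16 e250f7eaf0d80e96) — head `stub_DOWN_of_organs` :1951, junction `example : type_of% @F0P6aDatumOfInputs.stub_DOWN := @stub_DOWN_of_organs` :1978; in-file sockets 0 (sorry-free)
- ★ `…Theorems.F0P6aStubFROB` ← was `…Lines.F0_P6a_StubFROB` — ★ K6 twin (L3 closer leaf, LAST part = stem): head `stubFROB_of_parts` — ★ ACCEPTED p853574 (tree `Theorems/F0P6aStubFROB.lean`) — tree note: ED. 10 (S1): the L3 CLOSER LEAF (LA3 chair) ED. 5 (leaf bytes sha16 f9174234eccff5e5) — head `stubFROB_of_parts` :476, junction `example : type_of% @F0P6aDatumOfInputs.stub_FROB := @stubFROB_of_parts` :516; in-file sockets 0 (sorry-free)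
- ★ `HarnessLib.Audit.LibrarySuggestionsDenyListCruxes` ← was `HarnessLib.Audit.LibrarySuggestionsDenyListCruxes` — KEPT ★-side (v5; supersedes v1–v4՚s switch to plain `HarnessLib`): the ★ twin keeps the `…Cruxes.HLiu418.…` namespace and plain `HarnessLib` does NOT carry the «Cruxes» deny entry — probe `F0/P6/F0P6a-plan/g7/cov/stardeny.v1.run1.json`: deny list [HodgeCM, CorCM, …], `isDeniedPremise` = false on 294∕294 ★ constants of 16 landed ★ modules — so without this import every ★ lake build re-pays the `.olean` export fold of req547; gate-admissible import form (LA-ref1 BOX #34; ★ `F0D9opRoad2Mod` l.1 carries an `HarnessLib.Audit.…` companion); downstream ★ importers inherit the entry — tree note: ED. 10: build-lane export guard (operator companion, req547; LEAD «M-119b» carrier of record): the `Lean.LibrarySuggestions` indexers skip every `…Cruxes…` local theorem at `.olean` export — no statement ∕ proof ∕ attribute byte touched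


## Original module docstring (verbatim)
# F0-P6a (second sub-line) — `F0_P6a_ModuliDatum`: the MODULI CORE `RecordModuliPointwiseCoreCofinal` cut VERTICALLY (ED. 2 = `stub_UP` CUT: GEO ★ by name ∕ `stub_MH`; ED. 3 = `stub_MH` CUT: `mh_of_datum stub_RGD stub_HFROB stub_HEART`)

EDITION 10 (2026-09-02, desk F0P6a-plan (g6); LEAD F0P6-plan (g4) «M-81» (2) = (S1) «MAIN-SIDE D-CLOSERS SWAP BY IMPORT» (g5 cand 06ac82fa re-based by g6 on the sorry-free leaves); D-LINE pen F0P6c-plan MEMO e6b4c5fe): the TWO D-side socket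
arguments inside `stub_RGD`՚s body are replaced BY NAME by the heads of the D-closer leaves — `F0P6aDatumOfInputs.stub_DOWN` ↦ `F0P6aStubDOWN.stub_DOWN_of_organs` (L2 closer leaf
`Lines/F0_P6a_StubDOWN.lean` ED. 5, leaf bytes sha16 e250f7eaf0d80e96; junction of record `example : type_of% @stub_DOWN := @stub_DOWN_of_organs` :1978; in-file sockets 0 (sorry-free)) and `F0P6aDatumOfInputs.stub_FROB` ↦
`F0P6aStubFROB.stubFROB_of_parts` (L3 closer leaf `Lines/F0_P6a_StubFROB.lean` ED. 5, leaf bytes sha16 f9174234eccff5e5; junction `example : type_of% @stub_FROB := @stubFROB_of_parts` :516; in-file sockets 0 (sorry-free)).  TWO more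
`Lines` imports, TWO arguments (spelt `@…` like the L1 head, so binder-info differences between socket and leaf head are immaterial); NO other statement byte. ONE further ordinary import `HarnessLib.Audit.LibrarySuggestionsDenyListCruxes` (operator companion of record, req547 ∕ LEAD «M-119b»: the build-lane
`Lean.LibrarySuggestions` export folds skip every local theorem whose name has the component `Cruxes` — it adds no constant and touches no statement, proof, attribute or option).  The D-line՚s `stub_DOWN` ∕ `stub_FROB`
LEAVE main՚s cone (census heads stay in the D-line, paid BY WRITE by the leaves), so the machine sorry-source census behind `stub_RGD` is the LEAF DEBT BY NAME — with both leaves sorry-free and the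
X-leaf `F0P6aEExports` side paid (desk tie v3 13:36Z: census EXACTLY the two D-line sockets), the expected census below `stub_RGD` is ∅ and `--axioms stub_RGD` = TRIO, i.e. the parent՚s derived `F0D9opRoad2.stub_PWcore`
and its head `stub_D9op_holds` close in-tree modulo NOTHING on the MOD side (the kernel՚s `--axioms` line at the tie is the statement of record, not this paragraph).  CONSEQUENCE («M-81» (2)): from this edition on, an
edition of either D-closer leaf re-makes {leaf, `F0_P6a_ModuliDatum`, `F0_D9opRoad2`} instead of kicking alone.  Live tree-local `sorry`s of THIS file: 0.  HC_CM is proved only modulo the 2 remaining named inputs until rung 0 closes.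

EDITION 9 (2026-09-02, desk F0P6a-plan (g4); LEAD heir F0P6-plan (g3) «M-68» NEXT «MAIN ED. 9 swaps stub_GSPREAD ↦ ‹StubGSPREAD›.gspread_of_line»; LA4-plan (g2) 06:16:13Z (c) «swap BOTH by-write heads in ONE
edition»): the TWO remaining P-side socket arguments inside `stub_RGD`՚s body are replaced BY NAME by their sorry-free payers — `F0P6aPELSpread.stub_GSPREAD` ↦ `F0P6aStubGSPREAD.gspread_of_line`
((A2) closer leaf `Lines/F0_P6a_StubGSPREAD.lean` ED. 1 81473cadd2ed4a79, LA4-p03 (g2): `theorem gspread_of_line : type_of% @F0P6aPELSpread.stub_GSPREAD`, in-file sockets 0, TRIO) and `F0P6aPELInputs.stub_DUALS` ↦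
`Literature.AlgebraicGeometry.AbelianSchemes.MumfordDual.dualPairOfAmpleRigidified` (★ `Literature/AlgebraicGeometry/AbelianSchemes/DualPairOfAmpleRigidified.lean` :226, LA6-p02 (g0); `type_of% @stub_DUALS` by LA4-plan (g2)՚s
tie 5c6192d746d23cfc, TRIO).  TWO more imports, TWO arguments; NO other statement byte.  The P-line՚s `stub_DUALS` and the leaf՚s `stub_GSPREAD` LEAVE main՚s cone (census heads in their files, paid BY WRITE ∕ by ★),
so the debt behind `stub_RGD` is EXACTLY {`F0P6aStubGEN.stub_GEN`} ∪ {`stub_DOWN`, `stub_FROB`} — P-SIDE: ONE socket (`stub_GEN`, paid by the GEN leaf ED. 2 over the «M-67» X-leaf `F0P6aEExports.eLaws_of_frames` with NO main byte change);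
D-SIDE: the two D-line sockets closed by name by the L1∕L2∕L3 leaves as they land.  (Tree of record at this edition: spine ED. 4, P-LINE ED. 2, D-LINE ED. 2, L1 leaf, L4 leaf ED. 1, GEN leaf ED. 1, GSPREAD leaf ED. 1, L7 leaf ED. 2 (E-line head TRIO).)
Live tree-local `sorry`s of THIS file: 0.  HC_CM is proved only modulo the 2 remaining named inputs until rung 0 closes.

EDITION 8 (2026-09-02, desk F0P6a-plan (g4); LEAD heir F0P6-plan (g3) «M-55» (c) ∕ «M-66» NEXT; desk SOCKET PLAN (A) 04:40:15Z — the COLLECTING edition): the P-SIDE argument of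
`stub_RGD` reads the P-LINE՚s PARAMETRIC HEAD over the L4 CLOSER LEAF՚s PARAMETRIC HEAD, whose three slots are fed BY NAME —
`F0P6aPELInputs.pel_of_inputs (F0P6aPELSpread.spread_of_parts F0P6aPELSpread.stub_GSPREAD F0P6aPELSpread.stub_INJ0 F0P6aStubGEN.elaws_of_line) F0P6aPELInputs.stub_DUALS` in place of `F0P6aPELInputs.pel_of_line`
(P-LINE ED. 2 `pel_of_inputs (hSPREAD : DualPairOfAmpleRigidified → RecordPELSpreadCofinal) (hDUALS : DualPairOfAmpleRigidified) : RecordPELInputsCofinal`, sorry-free, TRIO; L4 leaf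
`Lines/F0_P6a_PELSpread.lean` ED. 1 4f143bbfae3e880b `spread_of_parts (hG : DualPairOfAmpleRigidified → RecordESpreadCofinal) (hI : DualPairOfAmpleRigidified → RecordInj0OfStageCofinal)
(hL : RecordPELELawsCofinal)`, sorry-free, with `stub_INJ0` PAID in-leaf; GEN closer leaf `Lines/F0_P6a_StubGEN.lean` ED. 1 head `elaws_of_line : type_of% @F0P6aPELSpread.stub_ELAWS`
(`rfl`-tied) := `elaws_of_parts stub_GEN heckeZip_holds twistZip_holds` — `twistZip_holds` TRIO over P-LINE §0c `kottRows_explicit` + ★ `frobKernelBanal_canTwistIdeal`, `heckeZip_holds` modulo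
E-READINGS `stub_HECKETRANS` until its ED. 3).  TWO more imports, ONE argument; NO other statement byte.  The P-line՚s `stub_SPREAD` and the leaf՚s `stub_ELAWS` LEAVE main՚s cone (they stay
in their files as census heads, paid BY WRITE: `@stub_SPREAD = @spread_of_line`, `@stub_ELAWS = @F0P6aStubGEN.elaws_of_line`, both `rfl`), so the debt behind `stub_RGD` is EXACTLY
{`stub_DUALS`} ∪ {`stub_GSPREAD`, `stub_GEN`} ∪ {`stub_DOWN`, `stub_FROB`} (+ E-READINGS `stub_HECKETRANS` until its ED. 3, + the printed P-1 letter via L7 `stub_RELEXP`); the NEXT main edition replaces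
`F0P6aPELSpread.stub_GSPREAD` by the head of its closer leaf (`StubGSPREAD.gspread_of_line`, LA4-p03) and nothing else.  (Tree of record at this edition: spine ED. 4, P-LINE ED. 2, D-LINE ED. 2,
L1 leaf, L4 leaf ED. 1, GEN leaf ED. 1 — ref1 (g4) e-17 erratum on ED. 7՚s ¶ below: read «spine ED. 4», «D-LINE ED. 2».)
Live tree-local `sorry`s of THIS file: 0.  HC_CM is proved only modulo the 2 remaining named inputs until rung 0 closes.

EDITION 7 (2026-09-02, desk heir F0P6a-plan (g4); LEAD F0P6-plan (g3) «M-53» (6), closing topology «M-39∕M-40», `F0/P6/HANDOFF.md` v14): `stub_RGD` reads the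
spine՚s PARAMETRIC HEAD over the two PAY-DOWN LINES — `stub_RGD := F0P6aRGDAssembly.rgd_of_inputs F0P6aPELInputs.pel_of_line F0P6aDatumOfInputs.datum_of_line`
(spine ED. 3 `rgd_of_inputs (hPEL : RecordPELInputsCofinal) (hDATUM : RecordDatumOfInputs) : RecordModuliDatumCofinal`, sorry-free; P-LINE `Lines/F0_P6a_PELInputs.lean`
ED. 1 head `pel_of_line` modulo its registered `stub_DUALS` ∕ `stub_SPREAD`; D-LINE `Lines/F0_P6a_DatumOfInputs.lean` ED. 1 head `datum_of_line` modulo its registered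
`stub_LINES` ∕ `stub_DOWN` ∕ `stub_FROB`) — TWO more imports, ONE body line; NO other byte.  The spine՚s `stub_PEL` ∕ `stub_DATUM` LEAVE main՚s cone (they stay in the
spine file as the in-file census `rgd_of_parts`); `pwcore_holds` closure = TRIO ∪ {sorryAx} through exactly the five pay-down stubs (+ the E-line՚s behind `stub_SPREAD`).
ED. 7 v2 (LEAD «M-59» (3); D-LINE ED. 2 `datum_of_inputs (hL : type_of% @stub_LINES) (hD : type_of% @stub_DOWN) (hF : type_of% @stub_FROB) : type_of% @datum_of_line`
PARAMETRIC HEAD, P6c (g4) ∕ B-p10 (g30), written in the same minute as this edition): the D-side argument is `datum_of_inputs @StubLINES.stub_LINES_of_organs stub_DOWN stub_FROB`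
— the L1 closer leaf PAYS `stub_LINES` BY NAME (sorry-free), so the D-side debt behind `stub_RGD` is EXACTLY {`stub_DOWN`, `stub_FROB`}; ED. 8 (after the L4 leaf
`Lines/F0_P6a_PELSpread` is written): the P-side argument becomes `pel_of_inputs F0P6aPELSpread.spread_of_line stub_DUALS` likewise.
Live tree-local `sorry`s of THIS file: 0.  HC_CM is proved only modulo the 2 remaining named inputs until rung 0 closes.

EDITION 6 (2026-09-01, desk heir F0P6a-plan (g3); LEAD F0P6-plan (g2) standing word «M-33» 23:06:07Z): `stub_HFROB` gets its BODY BY IMPORT —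
`intro F; intros; rename_i 𝔇; exact heartFrob_of_twistIdeal_ne_bot 𝔇 𝔇.twistIdeal_ne_bot` over the Σ-LINE `Lines/F0_P6a_StubHFROBSigma2.lean` (A-p13 (g36) ∕
A-p03 (g30), M-32: σ2-route HEART-FROB′ from the datum — Serre-tensor recognition of `A^{(q)}` ★ Σ `FrobeniusHeartSigma2Assembly` p847054, transfer brick ★ T
`TupleIsoAtOfFibreIsoPoints` p846893, ★ P p846958 — modulo the ONE side condition `𝔞_γ ≠ ⊥`, now the Defs ED. 3 field `ModuliDatum.twistIdeal_ne_bot`, M-24 (α));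
F0P6-ref1 (g3) docking rehearsal 63858204 GREEN (`RecordHeartFrobenius` is a plain `def`: `intro F` first, then `intros`).  NO other byte.  Live tree-local `sorry`s of THIS
file: 1 → 0; the cone՚s open sockets are exactly the RGD SPINE՚s registered `stub_PEL` ∕ `stub_DATUM` (+ the E-line՚s, behind `stub_PEL`): `pwcore_holds` closure =
TRIO ∪ {sorryAx} through those two only.  HC_CM is proved only modulo the 2 remaining named inputs until rung 0 closes.

EDITION 5 (2026-09-01, desk heir F0P6a-plan (g3), candidate (R) = (T) «TRIM» + «RGD BY IMPORT»; LEAD F0P6-plan (g2) word pending): `stub_HEART`՚s budget `set_option maxHeartbeats 1600000 → 400000`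
(cell rule «≤ 400000 per decl» restored; the LEAD waiver 21:31:13Z retires); EVERY OTHER BYTE is ED. 4 = F0P6c-plan (g3) DRAFT v2 d20553afe866070b (commit 41140d3e7e22; (EZ) BUILT s1066):
`stub_HEART : RecordHeartDictionary` PAID in-line over P6c ED. 3 `heart_of_carriers` ∕ `eq_kerF_or_isEtale_of_carriers` ∕ `quot_kerF_eq_of_lines` ∕ `nonempty_line_of_hecke` (735e6ed4e9ab2185) + ★ SHEET-COVER
p845161; live `sorry`s: EXACTLY 2 = {`stub_RGD`, `stub_HFROB`}.  (R): ONE more import `Lines/F0_P6a_RGDAssembly` (GEN heir A-p18 (g31) RGD SPINE ED. 1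
4819bd2d9dd79ad2, commit d653fcb785c5, (FB) BUILT; imports Defs only ⇒ no cycle) and `stub_RGD := F0P6aRGDAssembly.rgd_of_parts` BY NAME — main՚s tree-local bare `sorry`s become EXACTLY 1 =
{`stub_HFROB`}; `pwcore_holds` stays TRIO ∪ {sorryAx} through `stub_HFROB` ⊕ the spine՚s REGISTERED-BY-WRITE stubs `stub_PEL` ∕ `stub_DATUM` (count-neutral re-labelling; LINES FIRST, no registry act).

EDITION 3 (2026-09-01, LEAD F0P6-plan M-12 (A1) ∕ M-14 (4) ∕ M-15 (2) ∕ M-16c (1); F0P6-ref1 (g1) Q5, n25 J1–J7; desk censuses ED3-CENSUS v1 2313221a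
∕ v2Δ aca517a3 ∕ v2Δ-bis bf013962; `Cruxes/HLiu418/HEART-FROB.md` v4): `stub_MH` gets its BODY `mh_of_datum stub_RGD stub_HFROB stub_HEART` (§4.4′) —
`mh_of_datum : RecordModuliDatumCofinal → RecordHeartFrobenius → RecordHeartDictionary → RecordModuliHeartCofinal` PROVED here (the arithmetic Frobenius
`σ :=` ★ `exists_isAbsArithFrob_holds`, the sheet-wise `θ`-equivariant shadow `Fr₀ :=` ★ `IntegralModel.exists_sheetwise_frobeniusShadow … hdisj`, A-p01
(g23) p845200, BY NAME), the three letters and the MODULI DATUM `ModuliDatum` (layer (i) READING ∕ DICT data + TWIST; layer (ii) genuine identification)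
with its heart clause `HeartFrob` (HEART-FROB′, FORM-II, tuple-free) living in the new DEFS companion `Lines/F0_P6a_ModuliDatumDefs.lean` (one more
import; co-importable with the LEAD module, o-6-safe); every byte of §§1–4.3 and of the head is ED. 2; live `sorry`s: EXACTLY 3 = {`stub_RGD` (XL: REP +
GEN + HECKE + TWIST + INJ + FROB₀ + BANAL + `hdisj`), `stub_HFROB` (rank 2: HEART-FROB′), `stub_HEART` (L: the dictionary from the datum; formal at ED. 4 from
P6c՚s `heart_of_constructors`)}.

EDITION 2 (2026-09-01, LEAD F0P6-plan M-9; A-p18 (g27) census v2 7a1265c2): `stub_UP` gets its BODY `up_of_layers stub_MH` (§4) — the whole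
GEOMETRIC layer of the upstairs letter UP (thickening, Galois × level action, spread-out smooth–proper–projective model with the action extended and a
stable affine cover, units, the sheet lift) is PAID BY NAME from ★ organs (GEO-PKG `exists_integralPackage_eventually` A-p18 (g27) p845032, EQV-SPREAD
`IntegralModel.eventually_exists_actionOver_localise` A-p03 (g27) ∕ A-p01 (g23) p844965 ∕ p845041, GAL-4 `thickeningProdAction` + lemmas, P6q re-home of
`exists_levelQuotientAction_isGeometricQuotient`), and the ONE remaining stub is the MODULI HEART `stub_MH : RecordModuliHeartCofinal` (§4.2, XL),
typed THROUGH P6c՚s isogeny dictionary `PointDictionary` (DICT 81cfdcf7) in ONE `Γ`-compatible reading with the Frobenius sheet as a NAMED conjunct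
(`FrobeniusSheet`, §4.1) and reached in every reading by the proved transport `frobeniusDichotomy_map`; four more imports (★ GEO-PKG, ★ EQV-SPREAD,
`Lines/F0_P6q_TameLevelQuotient`, `Lines/F0_P6c_IsogenyDictionary` — all co-importable with the LEAD module); every byte of §§1–3 and of the head is
ED. 1′; live `sorry`s: EXACTLY 1 = {`stub_MH`} (split at ED. 3 = REP ∕ GEN ∕ HEART-fields ∕ FROB-SHEET).

EDITION 1′ (2026-09-01, LEAD F0P6-plan M-6 (A)): BODY-ONLY delta of ED. 1 v2 (tree 0fd3fb4ee730ec02, commit ee355b65853d) — `stub_GALQ` gets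
its proof (one application of ★ `IntegralModel.exists_tameQuotient_descAction_inv`, hand GALQ ∕ GALQ-INV of B-p18 (g34), ★ p844888) and the
file two more imports (★ `Motives/IntegralModelTameQuotientDescendedAction`, ★ `Motives/VarietiesProperProofs`); every STATEMENT byte of ED. 1 v2
is unchanged; live `sorry`s: EXACTLY 1 = {`stub_UP`} (cut at ED. 2 = GEO ∕ MH, census `ED2-CENSUS-P6a.v1` 8396c07d).

Cell `hodgecm-mathlib` (D-0151), programme F0, desk F0-P6 «MOD», sub-desk F0-P6a «PEL moduli & Kottwitz» — SECOND SUB-LINE of the crux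
**HLiu418** (`stmt-HodgeConjecture-24832`), opened on LEAD RULING M-1 (G) (F0∕P6 bus 2026-09-01T13:15:28Z): it imports the LEAD module
`Lines/F0D9opRoad2Mod.lean` (letters MOD-PWCORE `RecordModuliPointwiseCoreCofinal`, MOD-QUOT, `PointwiseFrobeniusDatumAt`, glue
`modv3_of_core_quot`) and concludes **`pwcore_holds : F0D9opRoad2.RecordModuliPointwiseCoreCofinal` BY NAME** from named stubs.

ED. 1 is the FIRST, VERTICAL cut of the moduli core — along the Galois layer `F ⊆ Fᵢ` that every honest moduli road must cross (the PEL ∕ RSZ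
moduli schemes live over rings of integers of the reflex ∕ moduli fields `Fᵢ ⊋ F`, the record curve `M⋆_{Kc}` over `F`; `M⋆_{Kc} ⊗_F Fᵢ` is a
union of moduli curves [Liu2021] Rem. C.2, [Kottwitz1992] §8, [Deligne1971TravauxShimura] 4.11–4.13):

* §1 LETTER UP `RecordModuliPointwiseCoreUpstairsCofinal` (stub `stub_UP`, XL — REP ∕ GEN ∕ LEV ∕ SPREAD ★ ∕ HEART live HERE, one layer up, where
  the dictionary «points = CM tuples» is NATIVE; split BY NAME over the moduli datum at ED. 2): cofinitely in the split place `w`, an `F`-scheme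
  `Y` with a finite group `Γ × G` acting (`Γ` = the Galois group of the thickening, `G = K ∕ Kc` the level group), `π : Y → M⋆_{Kc}` a GEOMETRIC
  QUOTIENT by `Γ` under which `G` covers the record translates `T_{k⁻¹}`, `|Γ|` and `|G|` invertible in `𝒪_{F,(w)}`, a smooth proper model `𝓨`
  of `Y` over `𝒪_{F,(w)}` to which the `Γ × G`-action extends with a stable affine cover, a set-theoretic section `ℓ` of `π` on `Ω`-points, and
  the pointwise Frobenius dichotomy UPSTAIRS MODULO `Γ` for the `ℓ`-lifts (`PointwiseFrobeniusDatumUpstairsAt`: the dichotomy holds in EVERY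
  `Γ`-invariant, Frobenius-compatible reading `mk : 𝓨_s(κ̄) → P` of the `κ̄(w)`-points of the special fibre — equivalently on the orbit set
  `𝓨_s(κ̄) ∕ Γ`; NOT in `𝓨_s(κ̄)` itself: the `q = N w`-Frobenius MOVES THE SHEET `κ(wᵢ) ↪ κ̄` of a point by `Frob_q` while all `ℓ`-lifts sit
  on the sheet of `e`, so pointwise equality upstairs is false at every `w` of residue degree `≥ 2` in `Fᵢ` — F0P6-ref1 BOX «P6a-2» o-5; what
  holds upstairs is `F̃ x̄ = θ(γ_w, 1) · ȳ_{β₀}` with `γ_w` the Frobenius element of the decomposition group, «FROB-SHEET»).  In print: `Y = Res_{Fᵢ∕F}`-restriction of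
  `M⋆_{Kc} ⊗_F Fᵢ = ⊔ⱼ 𝓜ⱼ ⊗ Fᵢ` (RSZ ∕ Kottwitz fine moduli schemes), `𝓨 =` the moduli scheme over `𝒪_{Fᵢ}[1⁄N]` VIEWED over `𝓞 F` and
  localised at `w` (smooth and proper for cofinitely many `w` by SPREADING OUT, ★ `Limits.LocApprox.eventually_smoothOfRelativeDimension_isProper
  _flat_atPrime_of_iso`), `Γ = Gal(Fᵢ∕F)` acting through the `𝒪_{Fᵢ}`-structure (semilinear = `𝓞 F`-linear model automorphisms), `ℓ =` ★
  `AlgPoints.ofAlong e` for an `F`-embedding `e : Fᵢ → Ω`, and the dichotomy = the Eichler–Shimura picture on CM tuples over `κ̄(w)` with the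
  `q = N w` Frobenius ([Liu2021] Prop. D.8, [Carayol1986Compositio] §10.3, [Wedhorn2000CongruenceRelation]) up to the decomposition group —
  the reason for working over `𝒪_{F,(w)}` and not over `𝒪_{Fᵢ,(wᵢ)}`, whose own `frobeniusOver` is the `q^f`-Frobenius.  LOGICALLY UP is
  PWCORE with a free extra Galois layer (`Γ = 1`, `Y = M⋆_{Kc}`, `ℓ = id` recovers PWCORE); its point is the freedom to take `Y` = the
  thickened MODULI SCHEME at ED. 2.
* §2 LETTER GALQ `RecordGaloisQuotientDescent` (stub `stub_GALQ`, M–L — PAID at ED. 1′ by ★ `IntegralModel.exists_tameQuotient_descAction_inv`, hand GALQ ∕ GALQ-INV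
  of B-p18 (g34); the twin of the LEAD՚s MOD-QUOT and sharing its engine):
  the TAME quotient `𝒮c := 𝓨 ∕ Γ` is a smooth proper model of `M⋆_{Kc}` (★ `Motives.IntegralModel.exists_quotient_of_isProper`, ★
  `ActionOver.smoothOfRelativeDimension_one_and_isProper_gluedDesc_of_isUnit_card`), the `G`-action DESCENDS to `ρ` on `𝒮c` with a stable affine
  cover and generic fibre `k ↦ T_{k⁻¹}` (★ `ActionOver.IsGeometricQuotient.desc`), and the quotient map `πq : 𝓨 → 𝒮c` is `Γ`-INVARIANT with
  generic fibre `π`.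
* §3 GLUE `pwcore_of_up_galq : UP → GALQ → PWCORE` PROVED: the map `πq_s` on `κ̄(w)`-points of the special fibres IS a `Γ`-invariant
  Frobenius-compatible reading (★ `AlgPoints.map_frobeniusOver_map`; invariance from GALQ), and ★ `IntegralModel.geomReductionMap_map` — the
  reduction map is natural in the model morphism `πq` — identifies `red_{𝒮c} P` with `πq_s (red_𝓨 (ℓ P))`; no injectivity, no moduli
  interpretation of `𝒮c` itself is ever needed.  Then the registered stubs and the head `pwcore_holds`.

Road discipline (REF1 OBJECTIONS #1–#3, R5, (P)): imports ONLY the LEAD module `Lines/F0D9opRoad2Mod.lean` (hence Body + sub-line 1) and, from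
ED. 1′, the two ★ Literature organs above, and from ED. 2 ★ GEO-PKG, ★ EQV-SPREAD and the sibling lines `F0_P6q_TameLevelQuotient` ∕
`F0_P6c_IsogenyDictionary`, and from ED. 3 the DEFS companion `F0_P6a_ModuliDatumDefs` (all co-importable with the LEAD module; NOT
`Theorems/F0P6aStubGALQ`, o-6); never
`Liu2021/RecordCurveEichlerShimura(.lean|Bridge)`, never `RecordCurveSec42Datum`, never the parent line; no instance, no notation; every
`sorry` sits inside a REGISTERED stub (from ED. 3: `stub_RGD`, `stub_HFROB`, `stub_HEART` only).  HONEST LABEL: HC_CM is proved only modulo the 2 remaining named inputs (hLiu418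
24832, h413 24833) — behind them the booked printed statements + the MOD package — until rung 0 closes; this file closes nothing by itself.
-/


namespace Summit.HodgeConjecture.HodgeConjecture.Cruxes.HLiu418.F0P6aModuliDatum

set_option linter.dupNamespace false  -- `Summit.HodgeConjecture.HodgeConjecture.…` BY DESIGN (D-0017), as in `Lines/d6_cm_curve.lean`

open CategoryTheory NumberField IsDedekindDomain MulAction
open scoped Matrix
open Literature.NumberTheory.GaloisRepresentations
open Literature.NumberTheory.Automorphic Literature.NumberTheory.Automorphic.UnitaryGroup
open Literature.AlgebraicGeometry.ShimuraVarieties.UnitaryCanonicalModel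
open Literature.NumberTheory.Automorphic.Liu2021.AppendixC
open Literature.AlgebraicGeometry.Motives (AlgPoints IntegralModel frobeniusOver SchemeOver)
open Literature.NumberTheory.DiophantineGeometry (geomResidueField specialFibreFunctor)
open Literature.AlgebraicGeometry.RelativeSpec (ActionOver)
open Literature.NumberTheory.EllipticCurves (genericFibre)
open Summit.HodgeConjecture.HodgeConjecture.Cruxes.HLiu418.F0P6aPointwiseFrobenius (FrobeniusDichotomy)
open Summit.HodgeConjecture.HodgeConjecture.Cruxes.HLiu418.F0D9opRoad2
  (PointwiseFrobeniusDatumAt RecordModuliPointwiseCoreCofinal)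

/-! ### §1 LETTER UP — the moduli core one Galois layer up -/

/-- **The pointwise Frobenius datum UPSTAIRS, MODULO `Γ` — `PointwiseFrobeniusDatumUpstairsAt … w hw Kc Y 𝓨 h𝓨 Γ G θ ℓ`**: for EVERY
`Γ`-INVARIANT, FROBENIUS-COMPATIBLE READING of the `κ̄(w)`-points of the special fibre `𝓨 ⊗ κ(w)` — a type `P`, a map
`mk : 𝓨_s(κ̄(w)) → P` and `Fr : P → P` with `mk ∘ F̃ = Fr ∘ mk` (`F̃ =` ★ `frobeniusOver`, the `N w`-Frobenius) and `mk (θ(γ, 1)_s · p) = mk p`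
for all `γ ∈ Γ` (`θ(γ, 1)_s =` ★ `specialFibreFunctor w` of the model automorphism) — the block of `PointwiseFrobeniusDatumAt … w hw Kc 𝒮c h𝒮c`
(LEAD module, token-for-token in the binders `N′ hN′Kc rc₁ hrc₁ hrcN₁ rc₂ hrc₂ hrcN₂ x′`) with the point set replaced by `P`, the Frobenius by
`Fr`, and every reduced point `red_{𝒮c} Q` (`Q = u x′`, `T_{rc₁ β} x′`, `T_{rc₂ β} x′`) by `mk (red_𝓨 (ℓ Q))`.  Equivalently (take `P =` the
orbit set, `mk = Quot.mk`): the dichotomy `FrobeniusDichotomy` of sub-line 1 holds on `𝓨_s(κ̄(w)) ∕ Γ`.  WHY MODULO `Γ` (F0P6-ref1 BOX «P6a-2»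
o-5, the SHEET obstruction): for the intended `Y = Res_F(M⋆_{Kc} ⊗_F Fᵢ)` every `κ̄(w)`-point of `𝓨_s` carries a sheet `κ(wᵢ) ↪ κ̄(w)`; `F̃`
composes the sheet with `Frob_q` while all `ℓ`-lifts (`ℓ = AlgPoints.ofAlong e`) lie on the sheet of `e`, so equality IN `𝓨_s(κ̄)` fails at
every `w` of residue degree `≥ 2` in `Fᵢ∕F`; what the Eichler–Shimura picture on CM tuples gives upstairs is `F̃ x̄ = θ(γ_w, 1)_s · ȳ_{β₀}` (etc.)
with `γ_w ∈ Γ` a Frobenius element («FROB-SHEET», an ED.-2 item of HEART ∕ LEV-up), i.e. exactly equality in every invariant reading.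
`Prop`-valued; nothing asserted. [cite: Liu2021, Prop. D.8 (1)–(3) p. 135 and proof of Cor. D.9 p. 139]
[cite: Carayol1986Compositio, §10.3, Prop. p. 211] [cite: Wedhorn2000CongruenceRelation, main theorem (Introduction)] -/
def PointwiseFrobeniusDatumUpstairsAt (F : Type) [Field F] [NumberField F] [IsCMField F] (ι₁ : F →+* ℂ)
    (Jstar : Matrix (Fin 2) (Fin 2) F)
    (K₀ : C5.OpenCompactSubgroup ↥(finAdelic ↥(maximalRealSubfield F) F (IsCMField.complexConj F) 2 Jstar))
    (S : RecordSystemGS F Jstar ι₁ K₀) (hU7ₛ : S.HeckeTranslateDefinedOver)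
    (hJ : (Jstar.map (IsCMField.complexConj F))ᵀ = Jstar) (hJu : IsUnit Jstar)
    (w : HeightOneSpectrum (𝓞 F)) (hw : (IsCMField.complexConj F) • w ≠ w)
    (Kc : C5.SmallLevel K₀) (Y : SchemeOver F)
    (𝓨 : IntegralModel (HeightOneSpectrum.valuationSubringAtPrime F w) F Y) (h𝓨 : 𝓨.IsSmoothProper 1)
    (Γ G : Type) [Group Γ] [Group G] (θ : ActionOver 𝓨.total.hom (Γ × G))
    (ℓ : AlgPoints (S.M.obj Kc) (AlgebraicClosure (w.adicCompletion F)) → AlgPoints Y (AlgebraicClosure (w.adicCompletion F))) : Prop :=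
  haveI : AlgebraicGeometry.IsProper 𝓨.total.hom := h𝓨.2
  ∀ (P : Type) (mk : AlgPoints 𝓨.reductionAt (geomResidueField w) → P) (Fr : P → P)
    (_hFr : ∀ p : AlgPoints 𝓨.reductionAt (geomResidueField w), mk (AlgPoints.map (frobeniusOver 𝓨.reductionAt) p) = Fr (mk p))
    (_hinv : ∀ (γ : Γ) (p : AlgPoints 𝓨.reductionAt (geomResidueField w)),
       mk (AlgPoints.map
             ((specialFibreFunctor w).map (Over.isoMk (θ.aut (γ, 1)) (θ.aut_comp (γ, 1))).hom : 𝓨.reductionAt ⟶ 𝓨.reductionAt) p)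
         = mk p)
    (N' : C5.SmallLevel K₀) (hN'Kc : N' ≤ Kc)
    (rc₁ : orbit (Kc.1.1 : Subgroup ↥(finAdelic ↥(maximalRealSubfield F) F (IsCMField.complexConj F) 2 Jstar))
         ((UnitaryGroup.heckeElementAt ↥(maximalRealSubfield F) F (IsCMField.complexConj F) 2 Jstar
             (⟨w, rfl⟩ : UnitaryGroup.PlacesOver F (w.under (𝓞 ↥(maximalRealSubfield F))))
             (IsCMField.complexConj_ne_one F) hJ hw (UnitaryGroup.isUnit_placeForm Jstar hJu w) (HeckeCharacter.uniformizer F w) 1 :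
           ↥(finAdelic ↥(maximalRealSubfield F) F (IsCMField.complexConj F) 2 Jstar)) :
           ↥(finAdelic ↥(maximalRealSubfield F) F (IsCMField.complexConj F) 2 Jstar) ⧸
             (Kc.1.1 : Subgroup ↥(finAdelic ↥(maximalRealSubfield F) F (IsCMField.complexConj F) 2 Jstar))) →
       ↥(finAdelic ↥(maximalRealSubfield F) F (IsCMField.complexConj F) 2 Jstar)),
    (∀ β, ((rc₁ β : ↥(finAdelic ↥(maximalRealSubfield F) F (IsCMField.complexConj F) 2 Jstar)) :
        ↥(finAdelic ↥(maximalRealSubfield F) F (IsCMField.complexConj F) 2 Jstar) ⧸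
          (Kc.1.1 : Subgroup ↥(finAdelic ↥(maximalRealSubfield F) F (IsCMField.complexConj F) 2 Jstar))) = β.1) →
    ∀ (hrcN₁ : ∀ β, C5.HeckeLE (rc₁ β) N' Kc)
      (rc₂ : orbit (Kc.1.1 : Subgroup ↥(finAdelic ↥(maximalRealSubfield F) F (IsCMField.complexConj F) 2 Jstar))
         ((UnitaryGroup.heckeElementAt ↥(maximalRealSubfield F) F (IsCMField.complexConj F) 2 Jstar
             (⟨w, rfl⟩ : UnitaryGroup.PlacesOver F (w.under (𝓞 ↥(maximalRealSubfield F))))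
             (IsCMField.complexConj_ne_one F) hJ hw (UnitaryGroup.isUnit_placeForm Jstar hJu w) (HeckeCharacter.uniformizer F w) 2 :
           ↥(finAdelic ↥(maximalRealSubfield F) F (IsCMField.complexConj F) 2 Jstar)) :
           ↥(finAdelic ↥(maximalRealSubfield F) F (IsCMField.complexConj F) 2 Jstar) ⧸
             (Kc.1.1 : Subgroup ↥(finAdelic ↥(maximalRealSubfield F) F (IsCMField.complexConj F) 2 Jstar))) →
       ↥(finAdelic ↥(maximalRealSubfield F) F (IsCMField.complexConj F) 2 Jstar)),
    (∀ β, ((rc₂ β : ↥(finAdelic ↥(maximalRealSubfield F) F (IsCMField.complexConj F) 2 Jstar)) :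
        ↥(finAdelic ↥(maximalRealSubfield F) F (IsCMField.complexConj F) 2 Jstar) ⧸
          (Kc.1.1 : Subgroup ↥(finAdelic ↥(maximalRealSubfield F) F (IsCMField.complexConj F) 2 Jstar))) = β.1) →
    ∀ (hrcN₂ : ∀ β, C5.HeckeLE (rc₂ β) N' Kc),
    ∀ x' : AlgPoints (S.M.obj N') (AlgebraicClosure (w.adicCompletion F)),
      FrobeniusDichotomy (P := P) Fr
        (mk (𝓨.geomReductionMap (ℓ (AlgPoints.map (S.M.map (homOfLE hN'Kc)) x'))))
        (fun β => mk (𝓨.geomReductionMap (ℓ (AlgPoints.map (recordHeckeTranslateGS S hU7ₛ (rc₁ β) N' Kc (hrcN₁ β)) x'))))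
        (fun β => mk (𝓨.geomReductionMap (ℓ (AlgPoints.map (recordHeckeTranslateGS S hU7ₛ (rc₂ β) N' Kc (hrcN₂ β)) x'))))

/-- **LETTER UP — `RecordModuliPointwiseCoreUpstairsCofinal`** (ED. 1; THE MODULI CORE ONE GALOIS LAYER UP).  For every record datum
`(F, ι₁, J⋆, K₀, S, hU7ₛ, hJ, hJu)` and small level `K` there is a finite `S₃(K)` such that at every split place `w ∉ S₃` with
`J⋆_w ∈ GL₂(𝒪_w)` and `K` hyperspecial-factorisable at `w|F⁺` there are: the sublevel `Kc ≤ K` (hyperspecial-factorisable at `w|F⁺`,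
normalised by `K`), the finite group `G = K∕Kc` (`φ : K ↠ G`, `ker φ = Kc`) of order invertible in `𝒪_{F,(w)}` — EXACTLY the first eleven
witnesses of MOD-PWCORE — and then, INSTEAD of PWCORE՚s model `𝒮c` of `M⋆_{Kc}`: an `F`-scheme `Y` with a morphism `π : Y → M⋆_{Kc}`, a finite
group `Γ` of order invertible in `𝒪_{F,(w)}`, an action `τ` of `Γ × G` on `Y` over `F` such that `π` is a GEOMETRIC QUOTIENT of `Y` by `Γ`
(★ `ActionOver.IsGeometricQuotient`) and `(1, φ k)` covers the record translate `T_{k⁻¹}` through `π` for every `k ∈ K`; a smooth proper model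
`𝓨` of `Y` over `𝒪_{F,(w)}` with an action `θ` of `Γ × G` over `Spec 𝒪_{F,(w)}` whose generic fibre through `𝓨.genericIso'` is `τ` and under
which every point lies in a stable affine open; a set-theoretic section `ℓ` of `π` on `Ω`-points (`Ω = \overline{F_w}`); and the upstairs
pointwise Frobenius datum MODULO `Γ`, `PointwiseFrobeniusDatumUpstairsAt … w hw Kc Y 𝓨 h𝓨 Γ G θ ℓ` (v2: in every `Γ`-invariant
Frobenius-compatible reading of `𝓨_s(κ̄(w))`; F0P6-ref1 o-5).  IN PRINT (the intended witnesses): `Fᵢ ⊇ F` a finite Galois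
extension containing the moduli ∕ reflex fields of the components, `Y = Res_{F}(M⋆_{Kc} ⊗_F Fᵢ)` (`SchemeOver.restrictScalars` of the base
change; `= ⊔ⱼ` RSZ ∕ Kottwitz fine moduli curves `𝓜ⱼ ⊗ Fᵢ` for the `n = 2` CM datum, [RapoportSmithlingZhang2020Diagonal] §4.1 Thm. 4.1,
[Kottwitz1992] §5 pp. 389–391, §8, [Lan2013] Thm. 1.4.1.11, generic fibre identified by [Deligne1971TravauxShimura] 4.11–4.13 ∕ [Liu2021] Rem. C.2),
`Γ = Gal(Fᵢ∕F)` acting on the `Fᵢ`-factor (so that `π` is the base change to `M⋆_{Kc}` of the `Γ`-torsor `Spec Fᵢ → Spec F`, a geometric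
quotient), `G` acting by `η ↦ η k` on level structures, `𝓨 =` the moduli scheme over `𝒪_{Fᵢ}[1∕N]` viewed over `𝓞 F` (`IntegralModel (𝓞 F) F Y`)
and LOCALISED at `w` — smooth and proper for all but finitely many `w` by SPREADING OUT its smooth projective generic fibre (★
`Limits.LocApprox.eventually_smoothOfRelativeDimension_isProper_flat_atPrime_of_iso`, EGA IV₃ 8.10.5, IV₄ 17.7.8; NO properness or
deformation theorem for the moduli problem is consumed), `θ =` the `𝓞 F`-linear model automorphisms (Galois acting semilinearly on the
`𝒪_{Fᵢ}`-structure, `G` by moduli functoriality), the stable affine cover from quasi-projectivity over the local base ([MumfordAV1970] §7,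
SGA 1 V 1.8), `ℓ = AlgPoints.ofAlong e` (★ `Motives/RestrictScalarsPoints`) for an `F`-embedding `e : Fᵢ → Ω`, `S₃(K) ⊇` the primes under `N`,
under `[K : Kc] · [Fᵢ : F]`, ramified in `Fᵢ`, and the finitely many bad primes of the spreading; the datum modulo `Γ` = the Eichler–Shimura
picture on CM tuples with the Frobenius element `γ_w` moving the sheet («FROB-SHEET»).  LOGICALLY UP is PWCORE with a free extra Galois layer
(`Γ = 1` recovers it); XL; REP ∕ GEN ∕ LEV ∕ SPREAD ★ ∕ HEART (+ DICT with F0-P6c, + FROB-SHEET) are its ED.-2 split BY NAME over the moduli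
datum.  NOT asserted here.
(print: Liu2021, Prop. D.8 (1)–(3) p. 135, proof of Cor. D.9 p. 139, Rem. C.2) (print: RapoportSmithlingZhang2020Diagonal, §4.1 Thm. 4.1 p. 17)
(print: Kottwitz1992, §5 pp. 389–391, §8) (print: Deligne1971TravauxShimura, 4.11–4.13) (print: EGAIV3, 8.10.5 (xii)) (print: EGAIV4, 17.7.8 (ii))
(print: MumfordAV1970, §7 Thm. p. 66) -/
def RecordModuliPointwiseCoreUpstairsCofinal : Prop :=
  ∀ (F : Type) [Field F] [NumberField F] [IsCMField F] [IsGalois ℚ F] (ι₁ : F →+* ℂ)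
    (Jstar : Matrix (Fin 2) (Fin 2) F)
    (K₀ : C5.OpenCompactSubgroup ↥(finAdelic ↥(maximalRealSubfield F) F (IsCMField.complexConj F) 2 Jstar))
    (S : RecordSystemGS F Jstar ι₁ K₀) (hU7ₛ : S.HeckeTranslateDefinedOver)
    (hJ : (Jstar.map (IsCMField.complexConj F))ᵀ = Jstar) (hJu : IsUnit Jstar) (K : C5.SmallLevel K₀),
    ∃ S₃ : Set (HeightOneSpectrum (𝓞 F)), S₃.Finite ∧
      ∀ w : HeightOneSpectrum (𝓞 F), w ∉ S₃ → ∀ hw : (IsCMField.complexConj F) • w ≠ w,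
        (UnitaryGroup.isUnit_placeForm Jstar hJu w).unit ∈ glInt 2 (w.adicCompletion F) →
          UnitaryGroup.IsHyperspecialAt ↥(maximalRealSubfield F) F (IsCMField.complexConj F) 2 Jstar K.1.1
            (w.under (𝓞 ↥(maximalRealSubfield F))) →
          ∃ (Kc : C5.SmallLevel K₀) (_hKcK : Kc ≤ K)
            (_hKc : UnitaryGroup.IsHyperspecialAt ↥(maximalRealSubfield F) F (IsCMField.complexConj F) 2 Jstar Kc.1.1
               (w.under (𝓞 ↥(maximalRealSubfield F))))
            (hn : ∀ k ∈ K.1.1, C5.HeckeLE k Kc Kc)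
            (G : Type) (_ : Group G) (_ : Finite G) (φ : ↥K.1.1 →* G) (_hφ : Function.Surjective φ)
            (_hφker : φ.ker = (Kc.1.1 : Subgroup ↥(finAdelic ↥(maximalRealSubfield F) F (IsCMField.complexConj F) 2 Jstar)).subgroupOf K.1.1)
            (_hcard : IsUnit ((Nat.card G : ℕ) : HeightOneSpectrum.valuationSubringAtPrime F w))
            (Y : SchemeOver F) (π : Y ⟶ S.M.obj Kc)
            (Γ : Type) (_ : Group Γ) (_ : Finite Γ)
            (_hcardΓ : IsUnit ((Nat.card Γ : ℕ) : HeightOneSpectrum.valuationSubringAtPrime F w))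
            (τ : ActionOver Y.hom (Γ × G))
            (_hτπ : (⟨τ.aut.comp (MonoidHom.inl Γ G), fun γ => τ.aut_comp (MonoidHom.inl Γ G γ)⟩ : ActionOver Y.hom Γ).IsGeometricQuotient
               π.left)
            (_hτT : ∀ k : ↥K.1.1,
               (τ.aut (1, φ k)).hom ≫ π.left
                 = π.left ≫
                     (recordHeckeTranslateGS S hU7ₛ
                       ((k : ↥(finAdelic ↥(maximalRealSubfield F) F (IsCMField.complexConj F) 2 Jstar))⁻¹) Kc Kc
                       (hn _ (K.1.1.inv_mem k.2))).left)
            (𝓨 : IntegralModel (HeightOneSpectrum.valuationSubringAtPrime F w) F Y) (h𝓨 : 𝓨.IsSmoothProper 1)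
            (θ : ActionOver 𝓨.total.hom (Γ × G))
            (_hcovθ : ∀ y : ↥𝓨.total.left, ∃ O : θ.StableAffineOpens, y ∈ O.1)
            (_hθ : ∀ a : Γ × G,
               (genericFibre (HeightOneSpectrum.valuationSubringAtPrime F w) F).map (Over.isoMk (θ.aut a) (θ.aut_comp a)).hom
                   ≫ 𝓨.genericIso'.hom
                 = 𝓨.genericIso'.hom ≫ (Over.isoMk (τ.aut a) (τ.aut_comp a)).hom)
            (ℓ : AlgPoints (S.M.obj Kc) (AlgebraicClosure (w.adicCompletion F)) →
               AlgPoints Y (AlgebraicClosure (w.adicCompletion F)))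
            (_hℓ : ∀ P, AlgPoints.map π (ℓ P) = P),
            PointwiseFrobeniusDatumUpstairsAt F ι₁ Jstar K₀ S hU7ₛ hJ hJu w hw Kc Y 𝓨 h𝓨 Γ G θ ℓ

end Summit.HodgeConjecture.HodgeConjecture.Cruxes.HLiu418.F0P6aModuliDatum
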